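import Literature.Analysis.FluidPDE.LerayEventualRegularityH1
import Literature.Analysis.FluidPDE.LerayHopfContinuationCorollaries
import HarnessLib

/-!
# Leray's small-data global theorem on `ℝ³` in `H¹` form: `‖u₀‖₂² ‖∇u₀‖₂² ≲ ν⁴` ⇒ the Leray–Hopf
# solution is strong for all time (Leray 1934 §§20, 34; Robinson–Rodrigo–Sadowski 2016, Lemma 6.13
# / Thm. 6.12)

Analysis/FluidPDE **proofs file** (theorems only: no definitions, no named facts, no `sorry`);
assembly of `LerayEnstrophyMonotone.lean` / `LerayEventualRegularityH1.lean` (the small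
energy–enstrophy monotonicity mechanism) into the consumer statement.

**Theorem (`exists_global_strong_of_small_energy_enstrophy`).** There is an absolute `c₀ > 0` such
that for every `ν > 0` and every divergence-free `u₀ ∈ H¹(ℝ³)` — `u₀ ∈ L²`, weakly divergence free,
with weak dissipation `∫⁻ |∇u₀|² ≤ a` — satisfying the scale-invariant smallness
`(‖u₀‖₂² + 1) · a < c₀ ν⁴` (with `‖u₀‖₂² = 2·kineticEnergy u₀`), there is a GLOBAL Leray–Hopf weak
solution `u` of the unforced system from `u₀` which is strong for all positive times:
`‖u(t)‖²_{H¹}` is finite and continuous on every `(0, T]`, tends to `‖u₀‖²_{H¹}` as `t → 0⁺`, and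
`∫⁻ |∇u(t)|² ≤ a` for every `t > 0`. By the proved weak–strong uniqueness
(`serrin_weak_strong_uniqueness_holds`) every Leray–Hopf solution from `u₀` coincides with it
slice-wise a.e. on every horizon (not restated). This is RRS 2016 Lemma 6.13 («there is `c` with:
`‖u₀‖‖∇u₀‖ ≤ c` ⇒ the strong solution exists for all `t ≥ 0`», proof via
`d/dt‖∇u‖² ≤ ‖∇u‖⁴(c‖u‖²‖∇u‖² − ν…)`) on the whole space; the torus twin is the tree's
`Torus.exists_global_classicalNS_of_small_energyEnstrophy`.

Proof: Leray's local regular solution `V` from `u₀` on `[0, d]`, `d = cν³/a²`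
(`leray_local_regular_H1_holds`), keeps `∫⁻|∇V|² ≤ a` (`exists_const_eWeakGradL2Sq_le_of_regular`);
it extends to a global Leray–Hopf solution `u` agreeing with `V` on `(0, d]`
(`IsLerayHopfOn.exists_isGlobalLerayHopf_extension_of_memLp`); from a good restarting time
`s ∈ (0, d)` (dense, `exists_isLerayHopfOn_restart_Ioo`) the window induction
`exists_isH1RegularOn_Icc_of_small_good_time` carries `H¹`-regularity and the bound to every
horizon. The `+1` in the smallness is the bookkeeping constant of that induction (any `E₀ > ‖u₀‖₂²`
would do).

## Mathlib / tree search

`lean search` (PRESEARCH recorded on the ns-claims bus 2026-08-27T11:03:54Z): small-data GLOBAL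
results in the tree on `ℝ³` are small-`L³` (`kato_global_small_holds`, `exists_clayA_of_small_L3`),
small
`Ḣ^{1/2}` (`fujita_kato_global_small_holds`, `exists_clayA_of_small_homSobolevHalf`), GIP
(`GIPKatoSmallData.small_data_global`); on `𝕋³` the classical forms of `TorusNSSmallDataGlobal`. No
whole-space statement for general `H¹` data with the `‖u₀‖₂‖∇u₀‖₂` smallness and a Leray–Hopf/strong
conclusion existed.

## References

* J. Leray, Acta Math. 63 (1934), §20 ((3.13)–(3.14)), §34. [Leray1934]
* J. C. Robinson, J. L. Rodrigo, W. Sadowski, *The Three-Dimensional Navier–Stokes Equations*, CUP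
  2016, Lemma 6.13, Thm. 6.12, Thm. 6.15. [RobinsonRodrigoSadowski2016]

WHAT THIS IS NOT: not a claim about NS regularity or blow-up; not a claim about any author beyond
the typed locator.
-/

noncomputable section

open MeasureTheory Set Function Filter Topology InnerProductSpace
open scoped ENNReal NNReal RealInnerProductSpace

namespace Literature.Analysis.FluidPDE

/-- **Leray / RRS Lemma 6.13 on `ℝ³`: small `‖u₀‖₂²·‖∇u₀‖₂²` gives a global strong Leray–Hopf
solution with non-increasing enstrophy bound.** See the module docstring.
[cite: RobinsonRodrigoSadowski2016, Lemma 6.13 and Thm. 6.12] [cite: Leray1934, §20 and §34] -/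
theorem exists_global_strong_of_small_energy_enstrophy :
    ∃ c₀ : ℝ, 0 < c₀ ∧ ∀ ⦃ν : ℝ⦄, 0 < ν →
      ∀ ⦃u₀ : EuclideanSpace ℝ (Fin 3) → EuclideanSpace ℝ (Fin 3)⦄, MemLp u₀ 2 volume →
        IsWeaklyDivFree u₀ → ∀ ⦃a : ℝ⦄, 0 < a → eWeakGradL2Sq u₀ ≤ ENNReal.ofReal a →
        (2 * VectorCalculus.kineticEnergy u₀ + 1) * a < c₀ * ν ^ 4 →
        ∃ u : ℝ → EuclideanSpace ℝ (Fin 3) → EuclideanSpace ℝ (Fin 3),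
          IsGlobalLerayHopf ν 0 u₀ u ∧
          (∀ T : ℝ, 0 < T → IsH1RegularOn (Ioc 0 T) u) ∧
          (∀ t : ℝ, 0 < t → eWeakGradL2Sq (u t) ≤ ENNReal.ofReal a) ∧
          Tendsto (fun t => eH1NormSq (u t)) (𝓝[>] 0) (𝓝 (eH1NormSq u₀)) := by
  obtain ⟨c, hc, hpack⟩ := leray_local_regular_H1_holds
  obtain ⟨c₁, hc₁, hgradV⟩ := exists_const_eWeakGradL2Sq_le_of_regular
  obtain ⟨c₂, hc₂, hglob⟩ := exists_isH1RegularOn_Icc_of_small_good_time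
  refine ⟨min c₁ c₂, lt_min hc₁ hc₂, ?_⟩
  intro ν hν u₀ hu₀ hdiv a ha hgrad hsmall
  set E₀ : ℝ := 2 * VectorCalculus.kineticEnergy u₀ + 1 with hE₀def
  have hKE : 0 ≤ VectorCalculus.kineticEnergy u₀ := kineticEnergy_nonneg u₀
  have hE₀ : 0 < E₀ := by rw [hE₀def]; linarith
  have hν4 : 0 < ν ^ 4 := by positivity
  have hsmall₁ : E₀ * a < c₁ * ν ^ 4 :=
    hsmall.trans_le (mul_le_mul_of_nonneg_right (min_le_left _ _) hν4.le)
  have hsmall₂ : (2 * VectorCalculus.kineticEnergy u₀ + 1) * a < c₂ * ν ^ 4 :=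
    hsmall.trans_le (mul_le_mul_of_nonneg_right (min_le_right _ _) hν4.le)
  -- Leray's regular solution on `[0, d]`, `d = c ν³ / a²`
  set d : ℝ := c * ν ^ 3 / a ^ 2 with hddef
  have hd : 0 < d := by positivity
  have hdc : a ^ 2 * d ≤ c * ν ^ 3 := by
    rw [hddef, mul_div_cancel₀ _ (by positivity : a ^ 2 ≠ 0)]
  obtain ⟨V, P, hV, hV0, hVreg, hVcl, hVpack⟩ := hpack hν hd hu₀ hdiv ha.le hgrad hdc
  -- energy along `V`
  have hEV : ∀ t ∈ Icc 0 d, ∫ x, ‖V t x‖ ^ 2 ≤ E₀ := by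
    obtain ⟨G, -, h0⟩ := hV.energy_ineq_zero
    intro t ht
    have h1 := h0 t ht
    have hforce :
        ∫ τ in (0 : ℝ)..t, ∫ x, ⟪(0 : ℝ → EuclideanSpace ℝ (Fin 3) → EuclideanSpace ℝ (Fin 3)) τ x,
          V τ x⟫ = 0 := by
      simp
    rw [hforce, add_zero] at h1
    have h2 : 0 ≤ ν * (∫⁻ τ in Ioo 0 t, ∫⁻ x, ENNReal.ofReal (frobeniusNormSq (G τ x))).toReal :=
      mul_nonneg hν.le ENNReal.toReal_nonneg
    have h3 : ∫ x, ‖V t x‖ ^ 2 = 2 * VectorCalculus.kineticEnergy (V t) := by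
      rw [VectorCalculus.kineticEnergy, ← mul_assoc, mul_inv_cancel₀ two_ne_zero, one_mul]
    rw [h3, hE₀def]
    linarith
  -- the enstrophy bound along `V`
  have hbdV : ∀ τ ∈ Icc 0 d, eWeakGradL2Sq (V τ) ≤ ENNReal.ofReal a :=
    hgradV hν hd hV hV0 hVreg hVcl hVpack hE₀ hEV ha.le hsmall₁ hgrad
  -- global Leray–Hopf extension agreeing with `V` on `(0, d]`
  obtain ⟨u, hu, huV⟩ := hV.exists_isGlobalLerayHopf_extension_of_memLp hν hu₀ hdiv
  -- from a good time in `(0, d)`: regularity and the bound up to any horizon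
  have hwin : ∀ T : ℝ, 0 < T → ∃ s ∈ Ioo 0 d, IsH1RegularOn (Icc s (T + d)) u ∧
      ∀ t ∈ Icc s (T + d), eWeakGradL2Sq (u t) ≤ ENNReal.ofReal a := by
    intro T hT
    have hT₁ : 0 < T + d := by linarith
    have hLH₁ : IsLerayHopfOn (T + d) ν 0 u₀ u := hu (T + d) hT₁
    obtain ⟨s, hs, hLHs⟩ :=
      hLH₁.exists_isLerayHopfOn_restart_Ioo hν.le le_rfl hd (by linarith)
    have hs' : s ∈ Ioo 0 (T + d) := ⟨hs.1, by linarith [hs.2]⟩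
    have hgs : eWeakGradL2Sq (u s) ≤ ENNReal.ofReal a := by
      rw [huV s ⟨hs.1, hs.2.le⟩]
      exact hbdV s ⟨hs.1.le, hs.2.le⟩
    obtain ⟨hreg, hbd⟩ := hglob hν hLH₁ hs' hLHs ha hsmall₂ hgs
    exact ⟨s, hs, hreg, hbd⟩
  -- the `H¹` norms of `u` and `V` agree on `(0, d]`
  have heq : ∀ t ∈ Ioc 0 d, eH1NormSq (u t) = eH1NormSq (V t) := fun t ht => by rw [huV t ht]
  refine ⟨u, hu, fun T hT => ?_, fun t ht => ?_, ?_⟩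
  · -- `H¹`-regularity on `(0, T]`
    obtain ⟨s, hs, hreg, -⟩ := hwin T hT
    have hfin : ∀ t ∈ Ioc 0 T, eH1NormSq (u t) < ⊤ := by
      intro t ht
      rcases le_or_gt t d with htd | htd
      · rw [heq t ⟨ht.1, htd⟩]; exact hVreg.1 t ⟨ht.1.le, htd⟩
      · exact hreg.1 t ⟨hs.2.le.trans htd.le, by linarith [ht.2]⟩
    refine ⟨hfin, fun t ht => ?_⟩
    -- continuity within `(0, T]` at `t`: on the closed pieces `[ε, d]` (from `V`) and `[s, T + d]`
    have hV' : ContinuousOn (fun τ => eH1NormSq (u τ)) (Ioc 0 d) :=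
      (hVreg.2.mono Ioc_subset_Icc_self).congr fun τ hτ => heq τ hτ
    rcases le_or_gt t d with htd | htd
    · -- near `t ≤ d`: use `V` on `(0, d]` glued with `[s, T+d]` when `t = d`
      rcases lt_or_eq_of_le htd with htd' | htd'
      · have hnhds : Ioc 0 d ∈ 𝓝[Ioc 0 T] t := by
          refine mem_nhdsWithin.2 ⟨Iio d, isOpen_Iio, htd', fun τ hτ => ⟨hτ.2.1, le_of_lt hτ.1⟩⟩
        exact (hV' t ⟨ht.1, htd⟩).mono_of_mem_nhdsWithin hnhds
      · -- `t = d`: both pieces contain `d`; continuity on their union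
        rw [htd'] at ht ⊢
        have h1 : ContinuousWithinAt (fun τ => eH1NormSq (u τ)) (Icc s d) d :=
          (hV'.mono fun τ hτ => ⟨hs.1.trans_le hτ.1, hτ.2⟩) d ⟨hs.2.le, le_rfl⟩
        have h2 : ContinuousWithinAt (fun τ => eH1NormSq (u τ)) (Icc d (T + d)) d :=
          (hreg.2.mono fun τ hτ => ⟨hs.2.le.trans hτ.1, hτ.2⟩) d ⟨le_rfl, by linarith⟩
        have h12 := h1.union h2
        have hnhds : Icc s d ∪ Icc d (T + d) ∈ 𝓝[Ioc 0 T] d := by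
          refine mem_nhdsWithin.2 ⟨Ioi s, isOpen_Ioi, hs.2, fun τ hτ => ?_⟩
          rcases le_or_gt τ d with h | h
          · exact Or.inl ⟨le_of_lt hτ.1, h⟩
          · exact Or.inr ⟨h.le, by linarith [hτ.2.2]⟩
        exact h12.mono_of_mem_nhdsWithin hnhds
    · have hnhds : Icc s (T + d) ∈ 𝓝[Ioc 0 T] t := by
        refine mem_nhdsWithin.2 ⟨Ioi s, isOpen_Ioi, hs.2.trans htd, fun τ hτ => ?_⟩
        exact ⟨le_of_lt hτ.1, by linarith [hτ.2.2]⟩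
      exact (hreg.2 t ⟨hs.2.le.trans htd.le, by linarith [ht.2]⟩).mono_of_mem_nhdsWithin hnhds
  · -- the enstrophy bound at every `t > 0`
    rcases le_or_gt t d with htd | htd
    · rw [huV t ⟨ht, htd⟩]; exact hbdV t ⟨ht.le, htd⟩
    · obtain ⟨s, hs, -, hbd⟩ := hwin t ht
      exact hbd t ⟨hs.2.le.trans htd.le, by linarith⟩
  · -- `H¹`-attainment of the datum
    have hc : ContinuousWithinAt (fun t => eH1NormSq (V t)) (Icc 0 d) 0 := hVreg.2 0 ⟨le_rfl, hd.le⟩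
    have h1 : Tendsto (fun t => eH1NormSq (V t)) (𝓝[>] 0) (𝓝 (eH1NormSq u₀)) := by
      have := hc.tendsto
      rw [hV0] at this
      rw [← nhdsWithin_Ioo_eq_nhdsGT hd]
      exact this.mono_left (nhdsWithin_mono _ Ioo_subset_Icc_self)
    refine h1.congr' ?_
    filter_upwards [Ioo_mem_nhdsGT hd] with t ht
    rw [huV t ⟨ht.1, ht.2.le⟩]

end Literature.Analysis.FluidPDE
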